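import Mathlib.Analysis.Normed.Module.Basic
import Mathlib.Analysis.Normed.Operator.ContinuousLinearMap
import Mathlib.Topology.Algebra.Module.Basic
import Mathlib.LinearAlgebra.Matrix.NonsingularInverse
import Mathlib.Tactic.Module
import Mathlib.Tactic.LinearCombination
import HarnessLib

/-!
# The differential of `Φ : G_J × G_K → Compl`, `(g₁, g₂) ↦ g₁g₂·I`, at `(e, e)` is an isomorphism
# `T_eG_J/T_eG_ℍ ⊕ T_eG_K/T_eG_ℍ ≅ T_I Compl` (Buskin–Izadi, Prop. 2.1), the triple transversality
# `T_eG/T_eG_ℍ = V_I ⊕ V_J ⊕ V_K` (Cor. 2.4, eq. (3)), and Prop. 2.5: `V_{I₁} ⊕ V_{I₂} ⊕ V_{I₃}` is direct iff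
# `I₁, I₂, I₃ ∈ S` are linearly independent — the linear algebra behind twistor path connectivity of `Compl` (Thm. 2.3)

Topic `Literature/Geometry/Hyperkaehler`, namespace `Literature.Geometry.Hyperkaehler.TwistorPath`. Written by the literature
seat `lit-w-verbitsky` (gen 15) of the cell `pub-hsemireg` (HodgeConjecture venture), 2026-08-25, as the kernel leg of the
MECHANISM of row V-V8 of that cell's Verbitsky table (twistor-path connectivity of the period domain of complex tori,
[BI20] Thm. 1 (2) = Thm. 2.3: "each connected component of `Compl` is twistor path connected") — the part of the printed proof
that is finite-dimensional linear algebra: the differential of the "rotation" map `Φ` is ONTO the tangent space of the period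
domain, so that (inverse function theorem, NOT here) rotating the cone `C_K` about `J` sweeps out a neighbourhood of `I` and
three twistor spheres join `I` to every nearby complex structure. THEOREMS ONLY (no definition, no named fact, no `sorry`);
imports Mathlib + HarnessLib only. Nothing in this file is a statement about the Hodge conjecture, and nothing here says that
any object of the cell is hyperholomorphic, rotable or carries a twistor line.

## Source, verbatim (arXiv v2 = the cell's numbering of record; "v2 p.N Lm" = PDF page N, text-layer line m of
## arXiv:1806.07831v2, sha256/16 9e1097db4f2fd005, dumped by the cell's `texts-verbitsky/pdftext.py`; the held corpus text
## `paper:arxiv-1806.07831` is arXiv v1, chunks p0008–p0009, same statements with v1's `G := GL⁺(V_ℝ)`)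

N. Buskin, E. Izadi, *Twistor lines in the period domain of complex tori*, arXiv:1806.07831v2 (28 Jun 2020) = Geom. Dedicata
213 (2021) 21–47 (journal pages unseen by the cell), §2 "Twistor path connectivity of `Compl`". Standing notation (§1.1, v2
p.5): `V_ℝ` a real vector space of dimension `4n`, `Compl` the complex structures on `V_ℝ`, `G = GL(V_ℝ)` acting by
conjugation `g·I = gIg⁻¹`, `G_I` the stabilizer of `I` (operators commuting with `I`), `G_ℍ = G_I ∩ G_J` for a quaternionic
triple `I, J, K = IJ` (`I² = J² = −1`, `IJ = −JI`), `S = S(I, J) = {aI + bJ + cK | a² + b² + c² = 1}` its twistor sphere,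
`T_eG = End V_ℝ`.

* §2.1, v2 p.9 L4–17: "Let `I, J, K` be a triple of complex structures belonging to a twistor sphere `S`. Consider the smooth
  mapping `Φ : G_J × G_K → Compl, (g₁, g₂) ↦ g₁g₂·I`, where, as before, the action on `Compl` is by conjugation … The mapping
  `Φ` clearly sends `G_ℍ × G_ℍ` to `I`, so that its differential `dΦ_(e,e)` factors through
  `d̃Φ_(e,e) : T_eG_J/T_eG_ℍ ⊕ T_eG_K/T_eG_ℍ → T_I Compl`."
* v2 p.9 L18–21, **Proposition 2.1.** "Suppose `I, J, K` is a quaternionic triple. The mapping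
  `d̃Φ_(e,e) : T_eG_J/T_eG_ℍ ⊕ T_eG_K/T_eG_ℍ → T_I Compl` is an isomorphism."
* v2 p.9 L22–37 (eq. (1)): "For a vector `X ∈ T_eG ≅ End V_ℝ` and `I ∈ Compl` we introduce the notation
  `Xᴵ = I⁻¹XI = IXI⁻¹ ∈ T_eG`. Every vector `X ∈ T_eG` can be uniquely decomposed into the sum of its `I`-commuting and
  `I`-anticommuting components `X = ½(X + Xᴵ) + ½(X − Xᴵ)`, so that … we get the natural isomorphism
  (1) `T_I Compl ≅ T_eG/T_eG_I ≅ {Y ∈ T_eG | YI = −IY}` … Similarly we may write `T_eG_J/T_eG_ℍ ≅ {Y ∈ T_eG | YI = −IY, YJ = JY}`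
  and `T_eG_K/T_eG_ℍ ≅ {Y ∈ T_eG | YI = −IY, YK = KY}`."
* v2 p.9 L38–p.10 L7 (proof, injectivity): "Consider `X ∈ T_eG_J`, `Y ∈ T_eG_K` and the vector `d̃Φ_(e,e)(X + T_eG_ℍ, Y + T_eG_ℍ)`,
  which is `dΦ_(e,e)(X + Y) = d/dt|_{t=0} (e^{tX}e^{tY}·I) = (X + Y)I − I(X + Y) ∈ T_I Compl`. Assume that this vector is
  zero, that is, `X + Y` commutes with `I`: (2) `I(X + Y) = (X + Y)I`. Then the conjugate `(X + Y)ᴶ = J⁻¹(X + Y)J = Xᴶ + Yᴶ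
  = X − JYJ` must also commute with `I`. Using that `Y` commutes with `K` we obtain `X − JYJ = X − JYKI = X − JKYI = X − IYI`.
  The commutation with `I` is expressed now by `I(X − IYI) = (X − IYI)I`, or `IX + YI = XI + IY`, which gives
  `I(X − Y) = (X − Y)I`. Adding the last equality to (2) side by side gives that `XI = IX`, hence `YI = IY`, which implies
  `X, Y ∈ T_eG_ℍ`. This proves the required injectivity of `d̃Φ_(e,e)`".
* v2 p.10 L8–30 (proof, surjectivity): "we may decompose an arbitrary `Y ∈ T_I Compl` into the sum of its `J`-commuting and
  `J`-anticommuting components, `Y = ½(Y + Yᴶ) + ½(Y − Yᴶ)`, each of which anticommutes with `I` and hence determines a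
  tangent vector in `T_I Compl`. Now, since `Y − ½(Y + Yᴶ) = ½(Y − Yᴶ)` anticommutes with both `I` and `J`, it commutes with
  `K = IJ`, while `Y + Yᴶ` anticommutes with `K`, so that averaging under `K` both sides of the last equality we get
  `½(Y − Yᴶ) = ½(Y + Yᴷ)`. Finally `Y = ½(Y + Yᴶ) + ½(Y + Yᴷ) ∈ T_eG_J/T_eG_ℍ ⊕ T_eG_K/T_eG_ℍ`, which proves the required
  inclusion and thus the surjectivity of `d̃Φ_(e,e)`. □"
* v2 p.10 L31–39, **Corollary 2.2.** "Suppose `I, J, K` is a quaternionic triple. The mapping `Φ` is a submersion at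
  `(e, e) ∈ G_J × G_K`, that is `dΦ_(e,e)(T_eG_J ⊕ T_eG_K) = T_I Compl`." (proof: by Prop. 2.1); p.10 L40–43, **Theorem 2.3.**
  "Given a complex structure `I ∈ End(V_ℝ)`, there is a neighborhood of `I` in the space of complex structures on `V_ℝ` such
  that, for any complex structure `I₁` in this neighborhood, there is a twistor path consisting of three spheres joining `I`
  to `I₁`. Consequently, each connected component of `Compl` is twistor path connected."
* §2.2, v2 p.11 L31–36, **Corollary 2.4.** "Another immediate consequence of the injectivity of `d̃Φ_(e,e)` proved in
  Proposition 2.1 is the following Corollary 2.4. For a quaternionic triple `I, J, K`, the triple intersection of the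
  submanifolds `G_I/G_ℍ, G_J/G_ℍ` and `G_K/G_ℍ` of the homogeneous space `G/G_ℍ` at `eG_ℍ` is transversal."; p.11 L43–46:
  "By Corollary 2.4, (3) `T_eG/T_eG_ℍ = V_I ⊕ V_J ⊕ V_K`, where we set `V_I := T_eG_I/T_eG_ℍ, V_J := T_eG_J/T_eG_ℍ,
  V_K := T_eG_K/T_eG_ℍ`."
* v2 p.11 L37–41, **Proposition 2.5.** "The following generalization of this transversality is one of the main ingredients of
  the proof of connectivity by generic twistor paths in Section 3. Proposition 2.5. Let `I₁, I₂, I₃` be complex structures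
  belonging to the same twistor sphere `S`. The submanifolds `G_{I₁}/G_ℍ, G_{I₂}/G_ℍ, G_{I₃}/G_ℍ` in `G/G_ℍ` intersect
  transversally (as a triple) if and only if `I₁, I₂, I₃` are linearly independent as vectors in `End(V_ℝ)`."; proof p.11
  L42–p.12 L85: "We shall prove that `T_eG/T_eG_ℍ` also decomposes into the direct sum of its subspaces `Vᵢ := T_eG_{Iᵢ}/T_eG_ℍ`,
  `i = 1, 2, 3`. Put `Iᵢ = aᵢI + bᵢJ + cᵢK` … Perturbing the quaternionic triple `I, J, K`, we may assume that all `aᵢ`,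
  `i = 1, 2, 3`, are nonzero. … This has a nontrivial solution if and only if the columns of the matrix, i.e., `I₁, I₂, I₃`,
  are linearly dependent. □"
* §3, v2 p.13 L51–52: "Proposition 2.5 tells us that, when `I₁, J₁, K₁` are linearly independent, `Φ_{I₁,J₁,K₁}` is a
  submersion near `(e, e) ∈ G_{J₁} × G_{K₁}`."

## What is formalised (`F` = `V_ℝ`, any real normed space; `I, J : F →L[ℝ] F` with `I² = J² = −1`, `JI = −IJ`, `K = I ∘ J`;
## "`X ∈ T_eG_L`" = "`X` commutes with `L`", "`X ∈ T_eG_ℍ`" = "`X` commutes with `I` and `J`", stated on vectors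
## `∀ v, X (L v) = L (X v)`; `dΦ_(e,e)(Z) = Z ∘ I − I ∘ Z`; all statements basis-free and dimension-free)

* §1–§2 the quaternionic identities and eq. (1): the `I`-commuting part `½(X − IXI)` and anticommuting part `½(X + IXI)`
  (`commPart_comm`, `antiPart_anti`, `commPart_add_antiPart`, uniqueness `eq_zero_of_comm_of_anti`).
* §3 **Prop. 2.1, injectivity, by the printed argument** (`J_W_J_comm_I`: `J`-conjugation preserves `I`-commutation;
  `J_Y_J_eq_I_Y_I`: `JYJ = IYI` for `Y ∈ T_eG_K`; **`comm_I_of_add_comm_I`**: `X ∈ T_eG_J`, `Y ∈ T_eG_K`, `[X + Y, I] = 0 ⟹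
  XI = IX ∧ YI = IY`).
* §4 **Prop. 2.1, surjectivity, by the printed splitting** (`bracket_I_anti`: `dΦ(Z)` always anticommutes with `I`;
  `commPart_J_anti_I`, `commPart_K_anti_I`; **`antiPart_J_eq_commPart_K`**: "averaging under `K`", `½(Y − Yᴶ) = ½(Y + Yᴷ)`
  for `YI = −IY` — checked by a direct one-line computation rather than the printed averaging; **`eq_commPart_J_add_commPart_K`**:
  `Y = ½(Y + Yᴶ) + ½(Y + Yᴷ)`; **`exists_bracket_I_eq`**: every `Y` with `YI = −IY` is `dΦ_(e,e)(X' + Y')` with `X' ∈ T_eG_J`,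
  `Y' ∈ T_eG_K`; **`bracket_I_eq_zero_iff`**: the kernel of `(X, Y) ↦ dΦ_(e,e)(X + Y)` on `T_eG_J × T_eG_K` is exactly
  `T_eG_ℍ × T_eG_ℍ`). Together: `d̃Φ_(e,e)` is injective with image `{Y | YI = −IY} = T_I Compl` (eq. (1)) — Prop. 2.1 and the
  algebraic content of Cor. 2.2.
* §5 **Cor. 2.4 / eq. (3)** (`comm_of_sum_three_eq_zero`: `X_I + X_J + X_K = 0` with `X_L ∈ T_eG_L` forces all three into
  `T_eG_ℍ` — "immediate consequence of the injectivity"; `exists_sum_three_eq`: `T_eG = T_eG_I + T_eG_J + T_eG_K`).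
* §6–§7 OUR ROAD to Prop. 2.5 (the printed proof perturbs `I, J, K` to make all `aᵢ ≠ 0` and then inverts the `3 × 3`
  coefficient matrix; we invert the same matrix without perturbing, via quaternionic coordinates): every `X ∈ End(V_ℝ)` is
  uniquely `A + BI + CJ + DK` with `A, B, C, D ∈ T_eG_ℍ` (`exists_quatCoord`, `quatCoord_eq_zero`); `[BI + CJ + DK, aI + bJ + cK]
  = 2((cC − bD)I + (aD − cB)J + (bB − aC)K)` (`bracket_quatCoord`, the cross product); hence `X ∈ T_eG_L`, `L = aI + bJ + cK ∈ S`,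
  iff `(B, C, D) = (aM, bM, cM)`, `M ∈ T_eG_ℍ` (`quatCoord_parallel_of_comm_twistor`, `comm_twistor_of_quatCoord_parallel`):
  `V_L ≅ T_eG_ℍ·L`.
* §8 **Prop. 2.5** for `Iᵢ = aᵢI + bᵢJ + cᵢK ∈ S` (`V_ℝ ≠ 0`): **`comm_of_sum_eq_zero_of_linearIndependent`** ("if":
  `Σ Xᵢ = 0`, `Xᵢ ∈ T_eG_{Iᵢ}`, rows `(aᵢ, bᵢ, cᵢ)` independent ⟹ `Xᵢ ∈ T_eG_ℍ`, by `Matrix.mul_nonsing_inv` on the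
  coefficient matrix), **`exists_sum_three_eq_of_linearIndependent`** (the SPANNING half of "`T_eG/T_eG_ℍ` also
  decomposes into the direct sum of its subspaces `Vᵢ`": every `X` is `X₁ + X₂ + X₃`, `Xᵢ ∈ T_eG_{Iᵢ}`, again by inverting
  the coefficient matrix, no dimension count), **`linearIndependent_of_transversal`** ("only if": a dependency
  `Σ gᵢ(aᵢ, bᵢ, cᵢ) = 0` gives `Xᵢ = gᵢIᵢ`, and `gᵢIᵢ ∉ T_eG_ℍ` by `not_comm_of_mem_sphere`), `linearIndependent_twistor_iff`
  ("linearly independent as vectors in `End(V_ℝ)`" ⟺ independent coefficient vectors, `coeff_eq_zero_of_twistor_eq_zero`),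
  assembled as **`transversal_iff_linearIndependent`** (directness ⟺ independence; "intersect transversally (as a triple)"
  is read, as in the printed proof — "Assume, on the contrary, that for certain vectors `X ∈ V₁, Y ∈ V₂` and `Z ∈ V₃` we
  have `X + Y + Z = 0`" — as directness of `V_{I₁} + V_{I₂} + V_{I₃}`); and the §3 p.13 remark
  **`comm_of_bracket_eq_zero_of_linearIndependent`**: for linearly independent `I₁, J₁, K₁ ∈ S`, `X ∈ T_eG_{J₁}`,
  `Y ∈ T_eG_{K₁}`, `[X + Y, I₁] = 0 ⟹ X, Y ∈ T_eG_ℍ` (the kernel half of "`Φ_{I₁,J₁,K₁}` is a submersion near `(e, e)`").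

## What is NOT here

`Φ` itself as a smooth map of Lie groups, `d̃Φ_(e,e)` as a map of quotient spaces / that it IS the differential (we work with
the formula `dΦ_(e,e)(X + Y) = (X + Y)I − I(X + Y)` the paper derives), Cor. 2.2's submersion and Thm. 2.3's conclusion
(open image by the inverse function theorem, three spheres through the cones `C_J`, `C_K`, connectedness of the components of
`Compl` — differential topology), Prop. 2.6 (the cone `C_I` is real-analytic of dimension `4n² + 1`), Cor. 2.7, §3 (generic
twistor paths, Prop. 3.1), and the surjectivity half of the p.13 remark for a non-orthogonal triple `I₁, J₁, K₁` (a dimension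
count, `4n² + 4n² = 8n²`; the dimensions `dim T_eG_ℍ = 4n²`, `dim T_I Compl = 8n²` are the cell's file
`AnticommutingComplexStructuresDimension.lean`, not imported here so that this leaf depends on Mathlib only). The companion
leaves `TwistorSphereTwoPoints.lean` (Lemma 1.1) and `AnticommutingComplexStructuresDimension.lean` (§1.4–§1.7) of the same
seat treat §1; nothing is shared between the three files beyond Mathlib.

## References

* [BuskinIzadi2020TwistorLinesTori] N. Buskin, E. Izadi, *Twistor lines in the period domain of complex tori*, Geom.
  Dedicata 213 (2021) 21–47 = arXiv:1806.07831v2, §2.1 (eq. (1), Prop. 2.1 with proof, Cor. 2.2, Thm. 2.3), §2.2 (Cor. 2.4,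
  eq. (3), Prop. 2.5 with proof), §3 p.13 L51–52 — read on the v2 PDF text layer (pp. 9–13) and in the corpus text of v1
  (`paper:arxiv-1806.07831`, chunks p0008–p0009: Prop. 2.1 "is injective" + Cor. 2.2 by dimension count in v1; v2 proves the
  isomorphism directly, and this file follows v2).
-/

noncomputable section

namespace Literature.Geometry.Hyperkaehler.TwistorPath

variable {F : Type*} [NormedAddCommGroup F] [NormedSpace ℝ F]

/-! ### §1 The quaternionic triple `I, J, K = IJ` -/

/-- `K² = −1` for `K = IJ`. [cite: BuskinIzadi2020TwistorLinesTori, v2 §1.1 (p.5 L36–38)] -/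
theorem K_K_apply {I J : F →L[ℝ] F} (hI : ∀ v, I (I v) = -v) (hJ : ∀ v, J (J v) = -v)
    (hIJ : ∀ v, J (I v) = -I (J v)) (v : F) : I (J (I (J v))) = -v := by
  simp [hIJ, hI, hJ]

/-- `KI = J`, i.e. `J v = I (J (I v))`. [cite: BuskinIzadi2020TwistorLinesTori, v2 §1.1 (p.5 L36–38)] -/
theorem I_J_I_apply {I J : F →L[ℝ] F} (hI : ∀ v, I (I v) = -v)
    (hIJ : ∀ v, J (I v) = -I (J v)) (v : F) : I (J (I v)) = J v := by
  simp [hIJ, hI]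

/-! ### §2 Eq. (1): commuting and anticommuting parts with respect to `I` -/

/-- **The `I`-commuting part `½(X + Xᴵ)`, `Xᴵ = IXI⁻¹ = −IXI`, commutes with `I`.**
[cite: BuskinIzadi2020TwistorLinesTori, v2 §2.1 (p.9 L22–32, eq. (1))] -/
theorem commPart_comm {I : F →L[ℝ] F} (hI : ∀ v, I (I v) = -v) (X : F →L[ℝ] F) (v : F) :
    ((1 / 2 : ℝ) • (X - I.comp (X.comp I))) (I v) = I (((1 / 2 : ℝ) • (X - I.comp (X.comp I))) v) := by
  simp only [_root_.smul_apply, _root_.sub_apply, ContinuousLinearMap.coe_comp, Function.comp_apply, hI, map_neg,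
    map_sub, map_smul, sub_neg_eq_add]
  module

/-- **The `I`-anticommuting part `½(X − Xᴵ) = ½(X + IXI)` anticommutes with `I`.**
[cite: BuskinIzadi2020TwistorLinesTori, v2 §2.1 (p.9 L22–32, eq. (1))] -/
theorem antiPart_anti {I : F →L[ℝ] F} (hI : ∀ v, I (I v) = -v) (X : F →L[ℝ] F) (v : F) :
    ((1 / 2 : ℝ) • (X + I.comp (X.comp I))) (I v) = -I (((1 / 2 : ℝ) • (X + I.comp (X.comp I))) v) := by
  simp only [_root_.smul_apply, _root_.add_apply, ContinuousLinearMap.coe_comp, Function.comp_apply, hI, map_neg,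
    map_add, map_smul]
  module

/-- **Eq. (1): `X = ½(X + Xᴵ) + ½(X − Xᴵ)`** — "Every vector `X ∈ T_eG` can be uniquely decomposed into the sum of its
`I`-commuting and `I`-anticommuting components". [cite: BuskinIzadi2020TwistorLinesTori, v2 §2.1 (p.9 L24–28, eq. (1))] -/
theorem commPart_add_antiPart (I X : F →L[ℝ] F) :
    (1 / 2 : ℝ) • (X - I.comp (X.comp I)) + (1 / 2 : ℝ) • (X + I.comp (X.comp I)) = X := by
  module

/-- Uniqueness in eq. (1): an operator that both commutes and anticommutes with `I` is zero.
[cite: BuskinIzadi2020TwistorLinesTori, v2 §2.1 (p.9 L24–25 "uniquely decomposed")] -/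
theorem eq_zero_of_comm_of_anti {I Z : F →L[ℝ] F} (hI : ∀ v, I (I v) = -v) (hc : ∀ v, Z (I v) = I (Z v))
    (ha : ∀ v, Z (I v) = -I (Z v)) : Z = 0 := by
  ext v
  have h1 : I (Z v) = 0 := by
    have := (hc v).symm.trans (ha v)
    have h2 : (2 : ℝ) • I (Z v) = 0 := by linear_combination (norm := module) this
    simpa using h2
  have h3 := congrArg I h1
  rw [hI, map_zero, neg_eq_zero] at h3
  simpa using h3

/-! ### §3 Proposition 2.1, injectivity: `X ∈ T_eG_J`, `Y ∈ T_eG_K`, `[X + Y, I] = 0 ⟹ X, Y ∈ T_eG_ℍ` -/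

/-- Conjugation by `J` preserves commutation with `I` (because `Iᴶ = J⁻¹IJ = −I`): if `WI = IW` then
`(JWJ)I = I(JWJ)`. [cite: BuskinIzadi2020TwistorLinesTori, v2 §2.1, proof of Prop. 2.1 (p.9 L51–52: "the conjugate
`(X + Y)ᴶ = J⁻¹(X + Y)J` … must also commute with `I`")] -/
theorem J_W_J_comm_I {I J W : F →L[ℝ] F} (hIJ : ∀ v, J (I v) = -I (J v)) (hW : ∀ v, W (I v) = I (W v)) (v : F) :
    J (W (J (I v))) = I (J (W (J v))) := by
  rw [hIJ, map_neg, hW, map_neg, hIJ, neg_neg]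

/-- "Using that `Y` commutes with `K` we obtain `X − JYJ = X − JYKI = X − JKYI = X − IYI`": for `Y` commuting with
`K = IJ`, `JYJ = IYI`. [cite: BuskinIzadi2020TwistorLinesTori, v2 §2.1, proof of Prop. 2.1 (p.9 L52–53)] -/
theorem J_Y_J_eq_I_Y_I {I J Y : F →L[ℝ] F} (hI : ∀ v, I (I v) = -v) (hJ : ∀ v, J (J v) = -v)
    (hIJ : ∀ v, J (I v) = -I (J v)) (hYK : ∀ v, Y (I (J v)) = I (J (Y v))) (v : F) :
    J (Y (J v)) = I (Y (I v)) := by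
  -- `J = KI`: `J v = K (I v)`, then move `K` past `Y` and use `JK = I`
  have h1 : J v = I (J (I v)) := (I_J_I_apply hI hIJ v).symm
  conv_lhs => rw [h1, hYK (I v)]
  simp [hIJ, hJ]

/-- **Proposition 2.1 (Buskin–Izadi), injectivity of `d̃Φ_(e,e)` — the printed argument.** Let `I, J, K = IJ` be a
quaternionic triple on `V_ℝ`, `X ∈ T_eG_J` (`XJ = JX`), `Y ∈ T_eG_K` (`YK = KY`), and assume
`dΦ_(e,e)(X + Y) = (X + Y)I − I(X + Y) = 0`, i.e. (2) `I(X + Y) = (X + Y)I`. "Then the conjugate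
`(X + Y)ᴶ = J⁻¹(X + Y)J = Xᴶ + Yᴶ = X − JYJ` must also commute with `I`. Using that `Y` commutes with `K` we obtain
`X − JYJ = X − IYI`. The commutation with `I` is expressed now by `I(X − IYI) = (X − IYI)I`, or `IX + YI = XI + IY`, which
gives `I(X − Y) = (X − Y)I`. Adding the last equality to (2) side by side gives that `XI = IX`, hence `YI = IY`".
[cite: BuskinIzadi2020TwistorLinesTori, v2 §2.1 Prop. 2.1 (p.9 L18–21), proof p.9 L38–p.10 L4] -/
theorem comm_I_of_add_comm_I {I J X Y : F →L[ℝ] F} (hI : ∀ v, I (I v) = -v) (hJ : ∀ v, J (J v) = -v)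
    (hIJ : ∀ v, J (I v) = -I (J v)) (hXJ : ∀ v, X (J v) = J (X v)) (hYK : ∀ v, Y (I (J v)) = I (J (Y v)))
    (h2 : ∀ v, X (I v) + Y (I v) = I (X v) + I (Y v)) :
    (∀ v, X (I v) = I (X v)) ∧ ∀ v, Y (I v) = I (Y v) := by
  -- (2): `W = X + Y` commutes with `I`; hence so does its `J`-conjugate `−JWJ = X − JYJ`
  have hW : ∀ v, (X + Y) (I v) = I ((X + Y) v) := fun v ↦ by simpa only [_root_.add_apply, map_add] using h2 v
  have hconj : ∀ v, -X (I v) + J (Y (J (I v))) = -I (X v) + I (J (Y (J v))) := by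
    intro v
    have h := J_W_J_comm_I hIJ hW v
    simp only [_root_.add_apply, map_add, hXJ, hJ, map_neg] at h
    linear_combination (norm := module) h
  -- `JYJ = IYI`, so `I(X − IYI) = (X − IYI)I`, i.e. `IX + YI = XI + IY`, i.e. `I(X − Y) = (X − Y)I`
  have hXY : ∀ v, X (I v) - Y (I v) = I (X v) - I (Y v) := by
    intro v
    have h := hconj v
    rw [J_Y_J_eq_I_Y_I hI hJ hIJ hYK, J_Y_J_eq_I_Y_I hI hJ hIJ hYK, hI, map_neg, map_neg, hI] at h
    linear_combination (norm := module) -h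
  -- add (2)
  have hX : ∀ v, X (I v) = I (X v) := by
    intro v
    have e : (2 : ℝ) • X (I v) = (2 : ℝ) • I (X v) := by linear_combination (norm := module) h2 v + hXY v
    exact smul_right_injective F two_ne_zero e
  refine ⟨hX, fun v ↦ ?_⟩
  have := h2 v
  rw [hX v] at this
  exact add_left_cancel this

/-! ### §4 Proposition 2.1, surjectivity: `T_I Compl = {Y | YI = −IY} = T_eG_J/T_eG_ℍ ⊕ T_eG_K/T_eG_ℍ` -/

/-- `dΦ_(e,e)(Z) = ZI − IZ` ALWAYS anticommutes with `I` (so `d̃Φ_(e,e)` lands in `T_I Compl ≅ {Y | YI = −IY}`, eq. (1)).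
[cite: BuskinIzadi2020TwistorLinesTori, v2 §2.1 (p.9 L41–47: "`dΦ_(e,e)(X + Y) = (X + Y)I − I(X + Y) ∈ T_I Compl`", eq. (1) p.9 L31–33)] -/
theorem bracket_I_anti {I : F →L[ℝ] F} (hI : ∀ v, I (I v) = -v) (Z : F →L[ℝ] F) (v : F) :
    (Z.comp I - I.comp Z) (I v) = -I ((Z.comp I - I.comp Z) v) := by
  simp only [_root_.sub_apply, ContinuousLinearMap.coe_comp, Function.comp_apply, hI, map_neg, map_sub]
  abel

/-- For `Y` ANTIcommuting with `I`, the `J`-commuting part `½(Y + Yᴶ) = ½(Y − JYJ)` still anticommutes with `I` ("each of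
which anticommutes with `I` and hence determines a tangent vector in `T_I Compl`"); it commutes with `J` by `commPart_comm`.
[cite: BuskinIzadi2020TwistorLinesTori, v2 §2.1, proof of Prop. 2.1 (p.10 L11–16)] -/
theorem commPart_J_anti_I {I J Y : F →L[ℝ] F} (hIJ : ∀ v, J (I v) = -I (J v)) (hY : ∀ v, Y (I v) = -I (Y v)) (v : F) :
    ((1 / 2 : ℝ) • (Y - J.comp (Y.comp J))) (I v) = -I (((1 / 2 : ℝ) • (Y - J.comp (Y.comp J))) v) := by
  simp only [_root_.smul_apply, _root_.sub_apply, ContinuousLinearMap.coe_comp, Function.comp_apply, hIJ, hY, map_neg,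
    map_sub, map_smul]
  module

/-- For `Y` anticommuting with `I`, the `K`-commuting part `½(Y + Yᴷ) = ½(Y − KYK)`, `K = IJ`, anticommutes with `I`.
[cite: BuskinIzadi2020TwistorLinesTori, v2 §2.1, proof of Prop. 2.1 (p.10 L11–27)] -/
theorem commPart_K_anti_I {I J Y : F →L[ℝ] F} (hI : ∀ v, I (I v) = -v) (hIJ : ∀ v, J (I v) = -I (J v))
    (hY : ∀ v, Y (I v) = -I (Y v)) (v : F) :
    ((1 / 2 : ℝ) • (Y - (I.comp J).comp (Y.comp (I.comp J)))) (I v) =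
      -I (((1 / 2 : ℝ) • (Y - (I.comp J).comp (Y.comp (I.comp J)))) v) := by
  simp only [_root_.smul_apply, _root_.sub_apply, ContinuousLinearMap.coe_comp, Function.comp_apply, hIJ, hY, hI,
    map_neg, map_sub, map_smul, neg_neg]
  module

/-- **"Averaging under `K`": for `Y` anticommuting with `I`, `½(Y − Yᴶ) = ½(Y + Yᴷ)`**, i.e. `½(Y + JYJ) = ½(Y − KYK)`.
Printed argument: "`Y − ½(Y + Yᴶ) = ½(Y − Yᴶ)` anticommutes with both `I` and `J`, it commutes with `K = IJ`, while
`Y + Yᴶ` anticommutes with `K`, so that averaging under `K` both sides of the last equality we get `½(Y − Yᴶ) = ½(Y + Yᴷ)`";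
here checked directly (`JYJ = −KYK` as soon as `YI = −IY`, a one-line computation).
[cite: BuskinIzadi2020TwistorLinesTori, v2 §2.1, proof of Prop. 2.1 (p.10 L16–24)] -/
theorem antiPart_J_eq_commPart_K {I J Y : F →L[ℝ] F} (hI : ∀ v, I (I v) = -v) (hIJ : ∀ v, J (I v) = -I (J v))
    (hY : ∀ v, Y (I v) = -I (Y v)) :
    (1 / 2 : ℝ) • (Y + J.comp (Y.comp J)) = (1 / 2 : ℝ) • (Y - (I.comp J).comp (Y.comp (I.comp J))) := by
  congr 1
  ext v
  simp only [_root_.add_apply, _root_.sub_apply, ContinuousLinearMap.coe_comp, Function.comp_apply, hIJ, hY, hI,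
    map_neg, neg_neg, sub_neg_eq_add]

/-- **"Finally `Y = ½(Y + Yᴶ) + ½(Y + Yᴷ) ∈ T_eG_J/T_eG_ℍ ⊕ T_eG_K/T_eG_ℍ`"**: every `Y` anticommuting with `I` is the
sum of a `J`-commuting and a `K`-commuting operator, both anticommuting with `I` (`commPart_comm`, `commPart_J_anti_I`,
`commPart_K_anti_I`). [cite: BuskinIzadi2020TwistorLinesTori, v2 §2.1, proof of Prop. 2.1 (p.10 L25–29)] -/
theorem eq_commPart_J_add_commPart_K {I J Y : F →L[ℝ] F} (hI : ∀ v, I (I v) = -v) (hIJ : ∀ v, J (I v) = -I (J v))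
    (hY : ∀ v, Y (I v) = -I (Y v)) :
    Y = (1 / 2 : ℝ) • (Y - J.comp (Y.comp J)) + (1 / 2 : ℝ) • (Y - (I.comp J).comp (Y.comp (I.comp J))) := by
  rw [← antiPart_J_eq_commPart_K hI hIJ hY]
  module

/-- **Proposition 2.1 (Buskin–Izadi), surjectivity of `d̃Φ_(e,e)`.** For a quaternionic triple `I, J, K = IJ` and any
`Y ∈ T_I Compl`, i.e. `YI = −IY` (eq. (1)), there are `X' ∈ T_eG_J` (`X'J = JX'`) and `Y' ∈ T_eG_K` (`Y'K = KY'`) with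
`dΦ_(e,e)(X' + Y') = (X' + Y')I − I(X' + Y') = Y`: take `W = −½YI` (which anticommutes with `I`, so `WI − IW = 2WI = Y`)
and split `W = ½(W + Wᴶ) + ½(W + Wᴷ)` as in the printed proof.
[cite: BuskinIzadi2020TwistorLinesTori, v2 §2.1 Prop. 2.1 (p.9 L18–21: "`d̃Φ_(e,e) : T_eG_J/T_eG_ℍ ⊕ T_eG_K/T_eG_ℍ → T_I Compl`
is an isomorphism"), surjectivity p.10 L8–29] -/
theorem exists_bracket_I_eq {I J Y : F →L[ℝ] F} (hI : ∀ v, I (I v) = -v) (hJ : ∀ v, J (J v) = -v)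
    (hIJ : ∀ v, J (I v) = -I (J v)) (hY : ∀ v, Y (I v) = -I (Y v)) :
    ∃ X' Y' : F →L[ℝ] F, (∀ v, X' (J v) = J (X' v)) ∧ (∀ v, Y' (I (J v)) = I (J (Y' v))) ∧
      (∀ v, (X' + Y') (I v) = -I ((X' + Y') v)) ∧ (X' + Y').comp I - I.comp (X' + Y') = Y := by
  set W : F →L[ℝ] F := -((1 / 2 : ℝ) • Y.comp I) with hWdef
  have hW : ∀ v, W (I v) = -I (W v) := fun v ↦ by
    simp only [hWdef, _root_.neg_apply, _root_.smul_apply, ContinuousLinearMap.coe_comp, Function.comp_apply, hI, hY,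
      map_neg, map_smul, neg_neg, smul_neg]
  have hKK : ∀ v, (I.comp J) ((I.comp J) v) = -v := fun v ↦ by
    simpa only [ContinuousLinearMap.coe_comp, Function.comp_apply] using K_K_apply hI hJ hIJ v
  refine ⟨(1 / 2 : ℝ) • (W - J.comp (W.comp J)), (1 / 2 : ℝ) • (W - (I.comp J).comp (W.comp (I.comp J))),
    commPart_comm hJ W, fun v ↦ ?_, fun v ↦ ?_, ?_⟩
  · simpa only [ContinuousLinearMap.coe_comp, Function.comp_apply] using commPart_comm hKK W v
  · rw [← eq_commPart_J_add_commPart_K hI hIJ hW]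
    exact hW v
  · rw [← eq_commPart_J_add_commPart_K hI hIJ hW]
    ext v
    simp only [hWdef, _root_.sub_apply, _root_.neg_apply, _root_.smul_apply, ContinuousLinearMap.coe_comp,
      Function.comp_apply, hI, hY, map_neg, map_smul, neg_neg]
    module

/-- **Proposition 2.1, both halves on elements.** For `X ∈ T_eG_J`, `Y ∈ T_eG_K`: `dΦ_(e,e)(X + Y) = 0` iff `X` and `Y` both
lie in `T_eG_ℍ` (commute with `I`, `J` and `K`) — the kernel statement behind "`d̃Φ_(e,e)` … is an isomorphism" (with
`exists_bracket_I_eq` for the image). [cite: BuskinIzadi2020TwistorLinesTori, v2 §2.1 Prop. 2.1 (p.9 L18–21, proof p.9 L38–p.10 L7)] -/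
theorem bracket_I_eq_zero_iff {I J X Y : F →L[ℝ] F} (hI : ∀ v, I (I v) = -v) (hJ : ∀ v, J (J v) = -v)
    (hIJ : ∀ v, J (I v) = -I (J v)) (hXJ : ∀ v, X (J v) = J (X v)) (hYK : ∀ v, Y (I (J v)) = I (J (Y v))) :
    (X + Y).comp I - I.comp (X + Y) = 0 ↔
      ((∀ v, X (I v) = I (X v)) ∧ (∀ v, X (J v) = J (X v))) ∧
        ((∀ v, Y (I v) = I (Y v)) ∧ (∀ v, Y (J v) = J (Y v))) := by
  constructor
  · intro h
    have h2 : ∀ v, X (I v) + Y (I v) = I (X v) + I (Y v) := fun v ↦ by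
      have := congrArg (fun T : F →L[ℝ] F ↦ T v) h
      simp only [_root_.sub_apply, _root_.add_apply, ContinuousLinearMap.coe_comp, Function.comp_apply,
        _root_.zero_apply, map_add, sub_eq_zero] at this
      exact this
    obtain ⟨hX, hY⟩ := comm_I_of_add_comm_I hI hJ hIJ hXJ hYK h2
    refine ⟨⟨hX, hXJ⟩, hY, fun v ↦ ?_⟩
    -- `Y` commutes with `I` and `K = IJ`, hence with `J = −IK`
    have h1 := hYK v
    rw [hY (J v)] at h1
    have h3 := congrArg I h1
    rw [hI, hI] at h3
    exact neg_injective h3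
  · rintro ⟨⟨hX, -⟩, hY, -⟩
    ext v
    simp [_root_.sub_apply, hX, hY]

/-! ### §5 Corollary 2.4, eq. (3): `T_eG/T_eG_ℍ = V_I ⊕ V_J ⊕ V_K` -/

/-- **Corollary 2.4 (Buskin–Izadi): "For a quaternionic triple `I, J, K`, the triple intersection of the submanifolds
`G_I/G_ℍ, G_J/G_ℍ` and `G_K/G_ℍ` of the homogeneous space `G/G_ℍ` at `eG_ℍ` is transversal"** — "another immediate
consequence of the injectivity of `d̃Φ_(e,e)`" — at the level of the tangent spaces `V_L = T_eG_L/T_eG_ℍ` (eq. (3)):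
if `X_I ∈ T_eG_I`, `X_J ∈ T_eG_J`, `X_K ∈ T_eG_K` and `X_I + X_J + X_K = 0` in `T_eG = End(V_ℝ)`, then all three lie in
`T_eG_ℍ` (commute with `I` and `J`, hence with `K`). Proof: `X_J + X_K = −X_I` commutes with `I`, so Prop. 2.1 applies.
[cite: BuskinIzadi2020TwistorLinesTori, v2 §2.2 Cor. 2.4 (p.11 L31–36), eq. (3) (p.11 L44–46)] -/
theorem comm_of_sum_three_eq_zero {I J X₁ X₂ X₃ : F →L[ℝ] F} (hI : ∀ v, I (I v) = -v) (hJ : ∀ v, J (J v) = -v)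
    (hIJ : ∀ v, J (I v) = -I (J v)) (h₁ : ∀ v, X₁ (I v) = I (X₁ v)) (h₂ : ∀ v, X₂ (J v) = J (X₂ v))
    (h₃ : ∀ v, X₃ (I (J v)) = I (J (X₃ v))) (hsum : X₁ + X₂ + X₃ = 0) :
    ((∀ v, X₁ (I v) = I (X₁ v)) ∧ (∀ v, X₁ (J v) = J (X₁ v))) ∧
      ((∀ v, X₂ (I v) = I (X₂ v)) ∧ (∀ v, X₂ (J v) = J (X₂ v))) ∧
        ((∀ v, X₃ (I v) = I (X₃ v)) ∧ (∀ v, X₃ (J v) = J (X₃ v))) := by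
  have h23 : X₂ + X₃ = -X₁ := by rw [← sub_eq_zero, sub_neg_eq_add, add_comm, ← add_assoc, hsum]
  have hker : (X₂ + X₃).comp I - I.comp (X₂ + X₃) = 0 := by
    ext v
    simp [h23, h₁]
  obtain ⟨hX₂, hX₃⟩ := (bracket_I_eq_zero_iff hI hJ hIJ h₂ h₃).mp hker
  have h1 : X₁ = -(X₂ + X₃) := by rw [h23, neg_neg]
  refine ⟨⟨h₁, fun v ↦ ?_⟩, hX₂, hX₃⟩
  simp [h1, hX₂.2, hX₃.2]

/-- **Eq. (3), spanning: `T_eG = T_eG_I + T_eG_J + T_eG_K`.** Every `X ∈ End(V_ℝ)` is `X_I + X_J + X_K` with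
`X_I = ½(X + Xᴵ) ∈ T_eG_I` and, writing `A = ½(X − Xᴵ)` for the `I`-anticommuting part, `X_J = ½(A + Aᴶ) ∈ T_eG_J`,
`X_K = ½(A + Aᴷ) ∈ T_eG_K` (eq. (1) and the splitting in the proof of Prop. 2.1).
[cite: BuskinIzadi2020TwistorLinesTori, v2 §2.2 eq. (3) (p.11 L44–46), §2.1 (p.9 L24–28, p.10 L25–27)] -/
theorem exists_sum_three_eq {I J : F →L[ℝ] F} (hI : ∀ v, I (I v) = -v) (hJ : ∀ v, J (J v) = -v)
    (hIJ : ∀ v, J (I v) = -I (J v)) (X : F →L[ℝ] F) :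
    ∃ X₁ X₂ X₃ : F →L[ℝ] F, (∀ v, X₁ (I v) = I (X₁ v)) ∧ (∀ v, X₂ (J v) = J (X₂ v)) ∧
      (∀ v, X₃ (I (J v)) = I (J (X₃ v))) ∧ X = X₁ + X₂ + X₃ := by
  set A : F →L[ℝ] F := (1 / 2 : ℝ) • (X + I.comp (X.comp I)) with hA
  have hAI : ∀ v, A (I v) = -I (A v) := antiPart_anti hI X
  have hKK : ∀ v, (I.comp J) ((I.comp J) v) = -v := fun v ↦ by
    simpa only [ContinuousLinearMap.coe_comp, Function.comp_apply] using K_K_apply hI hJ hIJ v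
  refine ⟨(1 / 2 : ℝ) • (X - I.comp (X.comp I)), (1 / 2 : ℝ) • (A - J.comp (A.comp J)),
    (1 / 2 : ℝ) • (A - (I.comp J).comp (A.comp (I.comp J))), commPart_comm hI X, commPart_comm hJ A, fun v ↦ ?_, ?_⟩
  · simpa only [ContinuousLinearMap.coe_comp, Function.comp_apply] using commPart_comm hKK A v
  · rw [add_assoc, ← eq_commPart_J_add_commPart_K hI hIJ hAI, hA, commPart_add_antiPart]

/-! ### §6 Quaternionic coordinates on `End(V_ℝ)`: `X = A + BI + CJ + DK` with `A, B, C, D ∈ T_eG_ℍ`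

The tool for Prop. 2.5 (our road; the printed proof perturbs the quaternionic triple instead, see §8): `End(V_ℝ)` is a free
module of rank `4` over the commutant `T_eG_ℍ = gl(V, ℍ)` of `I, J`, with basis `1, I, J, K` acting by right composition. -/

/-- **Uniqueness of quaternionic coordinates** — eq. (3) lifted to `T_eG`, uniqueness half: if `A, B, C, D` commute with `I`
and `J` and `A + BI + CJ + DK = 0`, then `A = B = C = D = 0` (the decomposition `X = X_I + X_J + X_K` of `T_eG/T_eG_ℍ` in the
normal form `X_I ≡ BI`, `X_J ≡ CJ`, `X_K ≡ DK (mod T_eG_ℍ)` is unique).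
[cite: BuskinIzadi2020TwistorLinesTori, v2 §2.2 eq. (3) (p.11 L44–51: "`T_eG/T_eG_ℍ = V_I ⊕ V_J ⊕ V_K` … Let `X := X_I + X_J + X_K`
be the decomposition of `X` into the sum of its components in the respective subspaces of (3)")] -/
theorem quatCoord_eq_zero {I J A B C D : F →L[ℝ] F} (hI : ∀ v, I (I v) = -v) (hJ : ∀ v, J (J v) = -v)
    (hIJ : ∀ v, J (I v) = -I (J v)) (hAI : ∀ v, A (I v) = I (A v)) (hAJ : ∀ v, A (J v) = J (A v))
    (hBI : ∀ v, B (I v) = I (B v)) (hBJ : ∀ v, B (J v) = J (B v)) (hCI : ∀ v, C (I v) = I (C v))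
    (hCJ : ∀ v, C (J v) = J (C v)) (hDI : ∀ v, D (I v) = I (D v)) (hDJ : ∀ v, D (J v) = J (D v))
    (h : A + B.comp I + C.comp J + D.comp (I.comp J) = 0) : A = 0 ∧ B = 0 ∧ C = 0 ∧ D = 0 := by
  have e0 : ∀ v, A v + I (B v) + J (C v) + I (J (D v)) = 0 := fun v ↦ by
    have := congrArg (fun T : F →L[ℝ] F ↦ T v) h
    simpa only [_root_.add_apply, ContinuousLinearMap.coe_comp, Function.comp_apply, _root_.zero_apply, hBI, hCJ, hDJ,
      hDI] using this
  -- conjugating by `I`: the `A, B` part and the `C, D` part vanish separately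
  have e1 : ∀ v, A v + I (B v) = 0 := fun v ↦ by
    have h0 := e0 v
    have h1 := congrArg I (e0 (I v))
    simp only [hAI, hBI, hCI, hDI, hI, hIJ, map_add, map_neg, map_zero, neg_neg] at h1
    have : (2 : ℝ) • (A v + I (B v)) = 0 := by linear_combination (norm := module) h0 - h1
    exact (smul_eq_zero.mp this).resolve_left two_ne_zero
  have e2 : ∀ v, J (C v) + I (J (D v)) = 0 := fun v ↦ by
    have h0 := e0 v
    rw [e1 v, zero_add] at h0
    exact h0
  -- conjugating by `J` separates `A` from `B` and `C` from `D`
  have hB : B = 0 := by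
    ext v
    have h1 := e1 (J v)
    have h2 := congrArg J (e1 v)
    simp only [hAJ, hBJ, hIJ, map_add, map_zero] at h1 h2
    have h3 : (2 : ℝ) • I (J (B v)) = 0 := by linear_combination (norm := module) h1 - h2
    have h4 : I (J (B v)) = 0 := (smul_eq_zero.mp h3).resolve_left two_ne_zero
    have h5 : J (B v) = 0 := by have := congrArg I h4; rwa [hI, map_zero, neg_eq_zero] at this
    have h6 : B v = 0 := by have := congrArg J h5; rwa [hJ, map_zero, neg_eq_zero] at this
    simpa using h6
  have hA : A = 0 := by
    ext v
    simpa [hB] using e1 v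
  have hD : D = 0 := by
    ext v
    have h1 := e2 (J v)
    have h2 := congrArg J (e2 v)
    simp only [hCJ, hDJ, hIJ, hJ, map_add, map_neg, map_zero] at h1 h2
    have h3 : (2 : ℝ) • I (D v) = 0 := by linear_combination (norm := module) h2 - h1
    have h4 : I (D v) = 0 := (smul_eq_zero.mp h3).resolve_left two_ne_zero
    have h5 : D v = 0 := by have := congrArg I h4; rwa [hI, map_zero, neg_eq_zero] at this
    simpa using h5
  have hC : C = 0 := by
    ext v
    have := e2 v
    rw [hD] at this
    simp only [_root_.zero_apply, map_zero, add_zero] at this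
    have h5 : C v = 0 := by have := congrArg J this; rwa [hJ, map_zero, neg_eq_zero] at this
    simpa using h5
  exact ⟨hA, hB, hC, hD⟩

/-- **Existence of quaternionic coordinates** — eq. (3) lifted to `T_eG`, existence half: every `X ∈ End(V_ℝ)` is
`A + BI + CJ + DK` with `A, B, C, D` commuting with `I` and `J` (`A ∈ T_eG_ℍ`, `BI ∈ T_eG_I`, `CJ ∈ T_eG_J`, `DK ∈ T_eG_K`):
`A = ¼(X − IXI − JXJ − KXK)`, `BI = ¼(X − IXI + JXJ + KXK)`, `CJ = ¼(X + IXI − JXJ + KXK)`, `DK = ¼(X + IXI + JXJ − KXK)` (the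
joint eigen-decomposition of the commuting involutions `X ↦ −IXI`, `X ↦ −JXJ`: eq. (1) applied twice).
[cite: BuskinIzadi2020TwistorLinesTori, v2 §2.2 eq. (3) (p.11 L44–51), §2.1 eq. (1) (p.9 L24–28)] -/
theorem exists_quatCoord {I J : F →L[ℝ] F} (hI : ∀ v, I (I v) = -v) (hJ : ∀ v, J (J v) = -v)
    (hIJ : ∀ v, J (I v) = -I (J v)) (X : F →L[ℝ] F) :
    ∃ A B C D : F →L[ℝ] F, (∀ v, A (I v) = I (A v)) ∧ (∀ v, A (J v) = J (A v)) ∧ (∀ v, B (I v) = I (B v)) ∧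
      (∀ v, B (J v) = J (B v)) ∧ (∀ v, C (I v) = I (C v)) ∧ (∀ v, C (J v) = J (C v)) ∧ (∀ v, D (I v) = I (D v)) ∧
      (∀ v, D (J v) = J (D v)) ∧ X = A + B.comp I + C.comp J + D.comp (I.comp J) := by
  set K : F →L[ℝ] F := I.comp J with hK
  refine ⟨(1 / 4 : ℝ) • (X - I.comp (X.comp I) - J.comp (X.comp J) - K.comp (X.comp K)),
    -((1 / 4 : ℝ) • (X - I.comp (X.comp I) + J.comp (X.comp J) + K.comp (X.comp K)).comp I),
    -((1 / 4 : ℝ) • (X + I.comp (X.comp I) - J.comp (X.comp J) + K.comp (X.comp K)).comp J),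
    -((1 / 4 : ℝ) • (X + I.comp (X.comp I) + J.comp (X.comp J) - K.comp (X.comp K)).comp K),
    fun v ↦ ?_, fun v ↦ ?_, fun v ↦ ?_, fun v ↦ ?_, fun v ↦ ?_, fun v ↦ ?_, fun v ↦ ?_, fun v ↦ ?_, ?_⟩
  all_goals first
    | ext v
      simp only [hK, _root_.add_apply, _root_.sub_apply, _root_.neg_apply, _root_.smul_apply,
        ContinuousLinearMap.coe_comp, Function.comp_apply, map_neg, hI, hJ, hIJ, neg_neg]
      module
    | simp only [hK, _root_.add_apply, _root_.sub_apply, _root_.neg_apply, _root_.smul_apply,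
        ContinuousLinearMap.coe_comp, Function.comp_apply, map_add, map_sub, map_neg, map_smul, hI, hJ, hIJ, neg_neg]
      module

/-- **The commutator with a point of the twistor sphere in quaternionic coordinates.** For `B, C, D` commuting with `I, J`
and `L = aI + bJ + cK`: `[BI + CJ + DK, L] = 2((cC − bD)I + (aD − cB)J + (bB − aC)K)` — the coefficient vector is the cross
product `(B, C, D) × (a, b, c)` (from `[I, J] = 2K`, `[J, K] = 2I`, `[K, I] = 2J`); `A ∈ T_eG_ℍ` contributes nothing.
[cite: BuskinIzadi2020TwistorLinesTori, v2 §2.2, proof of Prop. 2.5 (p.11 L48–53: "Put `Iᵢ = aᵢI + bᵢJ + cᵢK` … the commutation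
relation `[X, I₁] = 0` can be written as `a₁[X_J + X_K, I] + b₁[X_I + X_K, J] + c₁[X_I + X_J, K] = 0`")] -/
theorem bracket_quatCoord {I J B C D : F →L[ℝ] F} (hI : ∀ v, I (I v) = -v) (hJ : ∀ v, J (J v) = -v)
    (hIJ : ∀ v, J (I v) = -I (J v)) (hBI : ∀ v, B (I v) = I (B v)) (hBJ : ∀ v, B (J v) = J (B v))
    (hCI : ∀ v, C (I v) = I (C v)) (hCJ : ∀ v, C (J v) = J (C v)) (hDI : ∀ v, D (I v) = I (D v))
    (hDJ : ∀ v, D (J v) = J (D v)) (a b c : ℝ) :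
    (B.comp I + C.comp J + D.comp (I.comp J)).comp (a • I + b • J + c • I.comp J) -
        (a • I + b • J + c • I.comp J).comp (B.comp I + C.comp J + D.comp (I.comp J)) =
      (2 : ℝ) • ((c • C - b • D).comp I + (a • D - c • B).comp J + (b • B - a • C).comp (I.comp J)) := by
  ext v
  simp only [_root_.add_apply, _root_.sub_apply, _root_.smul_apply, ContinuousLinearMap.coe_comp, Function.comp_apply,
    map_add, map_smul, map_neg, hI, hJ, hIJ, hBI, hBJ, hCI, hCJ, hDI, hDJ, neg_neg, smul_neg]
  module

/-- An operator commuting with `I` and `J` ("preserving the quaternionic structure on `V_ℝ` determined by `I` and `J`", i.e.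
in `T_eG_ℍ`) commutes with every `aI + bJ + cK`: `T_eG_ℍ ⊆ T_eG_L` for all `L` in the span of the twistor sphere.
[cite: BuskinIzadi2020TwistorLinesTori, v2 §1.4 (p.6 L54–56: "`G_{I,J}` is the subgroup of elements of `G_I = GL(V)` commuting with
`J`, that is, preserving the quaternionic structure on `V_ℝ` determined by `I` and `J`, we have `G_{I,J} ≅ GL(V, ℍ)` which we
will also denote by `G_ℍ`")] -/
theorem comm_twistor_of_comm {I J A : F →L[ℝ] F} (hAI : ∀ v, A (I v) = I (A v)) (hAJ : ∀ v, A (J v) = J (A v))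
    (a b c : ℝ) (v : F) :
    A ((a • I + b • J + c • I.comp J) v) = (a • I + b • J + c • I.comp J) (A v) := by
  simp only [_root_.add_apply, _root_.smul_apply, ContinuousLinearMap.coe_comp, Function.comp_apply, map_add, map_smul,
    hAI, hAJ]

/-! ### §7 The commutant of a point `L = aI + bJ + cK` of the twistor sphere: `T_eG_L = T_eG_ℍ ⊕ T_eG_ℍ·L` -/

/-- **`T_eG_L` in quaternionic coordinates.** Let `L = aI + bJ + cK` with `a² + b² + c² = 1` and let
`X = A + BI + CJ + DK` (`A, B, C, D ∈ T_eG_ℍ`) commute with `L`. Then `(B, C, D) = (aM, bM, cM)` with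
`M = aB + bC + cD ∈ T_eG_ℍ`, i.e. `X = A + ML`: the vector `(B, C, D)` is parallel to `(a, b, c)` because its cross product with
`(a, b, c)` vanishes (`bracket_quatCoord`, `quatCoord_eq_zero`). So `V_L = T_eG_L/T_eG_ℍ ≅ T_eG_ℍ·L`.
[cite: BuskinIzadi2020TwistorLinesTori, v2 §2.2, proof of Prop. 2.5 (p.11 L46–p.12 L9: the decomposition of `X ∈ V₁` and the
three relations obtained from `[X, I₁] = 0`)] -/
theorem quatCoord_parallel_of_comm_twistor {I J A B C D : F →L[ℝ] F} (hI : ∀ v, I (I v) = -v) (hJ : ∀ v, J (J v) = -v)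
    (hIJ : ∀ v, J (I v) = -I (J v)) (hAI : ∀ v, A (I v) = I (A v)) (hAJ : ∀ v, A (J v) = J (A v))
    (hBI : ∀ v, B (I v) = I (B v)) (hBJ : ∀ v, B (J v) = J (B v)) (hCI : ∀ v, C (I v) = I (C v))
    (hCJ : ∀ v, C (J v) = J (C v)) (hDI : ∀ v, D (I v) = I (D v)) (hDJ : ∀ v, D (J v) = J (D v)) {a b c : ℝ}
    (habc : a ^ 2 + b ^ 2 + c ^ 2 = 1)
    (hX : ∀ v, (A + B.comp I + C.comp J + D.comp (I.comp J)) ((a • I + b • J + c • I.comp J) v) =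
      (a • I + b • J + c • I.comp J) ((A + B.comp I + C.comp J + D.comp (I.comp J)) v)) :
    B = a • (a • B + b • C + c • D) ∧ C = b • (a • B + b • C + c • D) ∧ D = c • (a • B + b • C + c • D) := by
  -- `[X, L] = [BI + CJ + DK, L]` (the `A`-part commutes) `= 2((cC − bD)I + (aD − cB)J + (bB − aC)K) = 0`
  have hbr : (B.comp I + C.comp J + D.comp (I.comp J)).comp (a • I + b • J + c • I.comp J) -
      (a • I + b • J + c • I.comp J).comp (B.comp I + C.comp J + D.comp (I.comp J)) = 0 := by
    ext v
    have h := hX v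
    have hA := comm_twistor_of_comm (I := I) (J := J) hAI hAJ a b c v
    simp only [_root_.sub_apply, _root_.add_apply, _root_.smul_apply, ContinuousLinearMap.coe_comp,
      Function.comp_apply, map_add, map_smul, _root_.zero_apply] at h hA ⊢
    linear_combination (norm := module) h - hA
  rw [bracket_quatCoord hI hJ hIJ hBI hBJ hCI hCJ hDI hDJ] at hbr
  have hbr' : (c • C - b • D).comp I + (a • D - c • B).comp J + (b • B - a • C).comp (I.comp J) = 0 :=
    (smul_eq_zero.mp hbr).resolve_left two_ne_zero
  have h0 := quatCoord_eq_zero (A := 0) (B := c • C - b • D) (C := a • D - c • B) (D := b • B - a • C) hI hJ hIJ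
    (fun v ↦ by simp) (fun v ↦ by simp) (fun v ↦ by simp [hCI, hDI]) (fun v ↦ by simp [hCJ, hDJ])
    (fun v ↦ by simp [hDI, hBI]) (fun v ↦ by simp [hDJ, hBJ]) (fun v ↦ by simp [hBI, hCI]) (fun v ↦ by simp [hBJ, hCJ])
    (by rw [zero_add]; exact hbr')
  obtain ⟨-, e1, e2, e3⟩ := h0
  refine ⟨?_, ?_, ?_⟩
  · linear_combination (norm := module) b • e3 - c • e2 - habc • B
  · linear_combination (norm := module) c • e1 - a • e3 - habc • C
  · linear_combination (norm := module) a • e2 - b • e1 - habc • D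

/-- Conversely, `A + ML` (`A, M ∈ T_eG_ℍ`) commutes with `L = aI + bJ + cK`: `T_eG_ℍ + T_eG_ℍ·L ⊆ T_eG_L`, so with
`quatCoord_parallel_of_comm_twistor` `V_L = T_eG_L/T_eG_ℍ ≅ T_eG_ℍ·L`.
[cite: BuskinIzadi2020TwistorLinesTori, v2 §1.4 (p.6 L54–56), §2.2 (p.11 L46–48: the subspaces `Vᵢ := T_eG_{Iᵢ}/T_eG_ℍ`)] -/
theorem comm_twistor_of_quatCoord_parallel {I J A M : F →L[ℝ] F} (hI : ∀ v, I (I v) = -v) (hJ : ∀ v, J (J v) = -v)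
    (hIJ : ∀ v, J (I v) = -I (J v)) (hAI : ∀ v, A (I v) = I (A v)) (hAJ : ∀ v, A (J v) = J (A v))
    (hMI : ∀ v, M (I v) = I (M v)) (hMJ : ∀ v, M (J v) = J (M v)) (a b c : ℝ) (v : F) :
    (A + M.comp (a • I + b • J + c • I.comp J)) ((a • I + b • J + c • I.comp J) v) =
      (a • I + b • J + c • I.comp J) ((A + M.comp (a • I + b • J + c • I.comp J)) v) := by
  simp only [_root_.add_apply, _root_.smul_apply, ContinuousLinearMap.coe_comp, Function.comp_apply, map_add, map_smul,
    hAI, hAJ, hMI, hMJ, hI, hJ, hIJ, map_neg, smul_neg, neg_neg]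
  module

/-! ### §8 Proposition 2.5: `V_{I₁} ⊕ V_{I₂} ⊕ V_{I₃} = T_eG/T_eG_ℍ` iff `I₁, I₂, I₃ ∈ S` are linearly independent -/

/-- `(aI + bJ + cK)² = −(a² + b² + c²)`. [cite: BuskinIzadi2020TwistorLinesTori, v2 §1.1 (p.5 L36–38: "`S(I, J) := {aI + bJ + cK | a² + b² + c² = 1}`")] -/
theorem twistor_comp_self_apply {I J : F →L[ℝ] F} (hI : ∀ v, I (I v) = -v) (hJ : ∀ v, J (J v) = -v)
    (hIJ : ∀ v, J (I v) = -I (J v)) (a b c : ℝ) (v : F) :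
    (a • I + b • J + c • I.comp J) ((a • I + b • J + c • I.comp J) v) = -((a ^ 2 + b ^ 2 + c ^ 2) • v) := by
  simp only [_root_.add_apply, _root_.smul_apply, ContinuousLinearMap.coe_comp, Function.comp_apply, map_add, map_smul,
    hI, hJ, hIJ, map_neg, smul_neg, neg_neg]
  module

/-- On `V_ℝ ≠ 0` the operators `I, J, K` are linearly independent: `aI + bJ + cK = 0 ⟹ a = b = c = 0` (square it:
`(aI + bJ + cK)² = −(a² + b² + c²)`), so that "linearly independent as vectors in `End(V_ℝ)`" can be read on coefficients.
[cite: BuskinIzadi2020TwistorLinesTori, v2 §2.2 Prop. 2.5 (p.11 L41: "linearly independent as vectors in `End(V_ℝ)`"), §1.1 (p.5 L36–38)] -/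
theorem coeff_eq_zero_of_twistor_eq_zero [Nontrivial F] {I J : F →L[ℝ] F} (hI : ∀ v, I (I v) = -v)
    (hJ : ∀ v, J (J v) = -v) (hIJ : ∀ v, J (I v) = -I (J v)) {a b c : ℝ} (h : a • I + b • J + c • I.comp J = 0) :
    a = 0 ∧ b = 0 ∧ c = 0 := by
  obtain ⟨v₀, hv₀⟩ := exists_ne (0 : F)
  have hsq := twistor_comp_self_apply hI hJ hIJ a b c v₀
  rw [h, _root_.zero_apply, eq_comm, neg_eq_zero, smul_eq_zero] at hsq
  have h0 : a ^ 2 + b ^ 2 + c ^ 2 = 0 := hsq.resolve_right hv₀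
  have ha : a ^ 2 = 0 := by nlinarith [sq_nonneg a, sq_nonneg b, sq_nonneg c]
  have hb : b ^ 2 = 0 := by nlinarith [sq_nonneg a, sq_nonneg b, sq_nonneg c]
  have hc : c ^ 2 = 0 := by nlinarith [sq_nonneg a, sq_nonneg b, sq_nonneg c]
  exact ⟨pow_eq_zero_iff two_ne_zero |>.mp ha, pow_eq_zero_iff two_ne_zero |>.mp hb,
    pow_eq_zero_iff two_ne_zero |>.mp hc⟩

/-- "linearly independent as vectors in `End(V_ℝ)`" = linear independence of the coefficient vectors in `ℝ³` (`V_ℝ ≠ 0`):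
`u ↦ u₀I + u₁J + u₂K` is an injective linear map `ℝ³ → End(V_ℝ)`.
[cite: BuskinIzadi2020TwistorLinesTori, v2 §2.2 Prop. 2.5 (p.11 L39–41)] -/
theorem linearIndependent_twistor_iff [Nontrivial F] {I J : F →L[ℝ] F} (hI : ∀ v, I (I v) = -v)
    (hJ : ∀ v, J (J v) = -v) (hIJ : ∀ v, J (I v) = -I (J v)) {ι : Type*} {u : ι → Fin 3 → ℝ}
    {L : ι → F →L[ℝ] F} (hL : ∀ i, L i = u i 0 • I + u i 1 • J + u i 2 • I.comp J) :
    LinearIndependent ℝ L ↔ LinearIndependent ℝ u := by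
  let f : (Fin 3 → ℝ) →ₗ[ℝ] (F →L[ℝ] F) :=
    (LinearMap.proj 0).smulRight I + (LinearMap.proj 1).smulRight J + (LinearMap.proj 2).smulRight (I.comp J)
  have hf : ∀ w : Fin 3 → ℝ, f w = w 0 • I + w 1 • J + w 2 • I.comp J := fun w ↦ rfl
  have hLf : L = f ∘ u := funext fun i ↦ by rw [Function.comp_apply, hf, hL]
  have hker : LinearMap.ker f = ⊥ := by
    rw [LinearMap.ker_eq_bot']
    intro w hw
    rw [hf] at hw
    obtain ⟨h0, h1, h2⟩ := coeff_eq_zero_of_twistor_eq_zero hI hJ hIJ hw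
    ext j
    fin_cases j <;> assumption
  rw [hLf]
  exact f.linearIndependent_iff hker

/-- **Proposition 2.5 (Buskin–Izadi), "if": linearly independent `I₁, I₂, I₃ ∈ S` are transversal.** Let `I, J, K = IJ` be a
quaternionic triple, `Iᵢ = aᵢI + bᵢJ + cᵢK ∈ S` (`aᵢ² + bᵢ² + cᵢ² = 1`, `i = 1, 2, 3`) with `(aᵢ, bᵢ, cᵢ)ᵢ` linearly independent,
and `Xᵢ ∈ T_eG_{Iᵢ}` with `X₁ + X₂ + X₃ = 0`. Then every `Xᵢ ∈ T_eG_ℍ` — "`T_eG/T_eG_ℍ` also decomposes into the direct sum of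
its subspaces `Vᵢ := T_eG_{Iᵢ}/T_eG_ℍ`". Our road (the printed proof perturbs `I, J, K` to make all `aᵢ ≠ 0` and inverts the
same `3 × 3` matrix of coefficients): in quaternionic coordinates `Xᵢ = Aᵢ + MᵢIᵢ` (§7), so `Σ Xᵢ = 0` gives
`Σᵢ aᵢMᵢ = Σᵢ bᵢMᵢ = Σᵢ cᵢMᵢ = 0` (§6), and the invertible coefficient matrix kills the `Mᵢ`.
[cite: BuskinIzadi2020TwistorLinesTori, v2 §2.2 Prop. 2.5 (p.11 L39–41), proof p.11 L42–p.12 L85 ("This has a nontrivial solution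
if and only if the columns of the matrix, i.e., `I₁, I₂, I₃`, are linearly dependent")] -/
theorem comm_of_sum_eq_zero_of_linearIndependent {I J : F →L[ℝ] F} (hI : ∀ v, I (I v) = -v) (hJ : ∀ v, J (J v) = -v)
    (hIJ : ∀ v, J (I v) = -I (J v)) {u : Fin 3 → Fin 3 → ℝ} (hu : ∀ i, u i 0 ^ 2 + u i 1 ^ 2 + u i 2 ^ 2 = 1)
    (hli : LinearIndependent ℝ u) {L : Fin 3 → F →L[ℝ] F} (hL : ∀ i, L i = u i 0 • I + u i 1 • J + u i 2 • I.comp J)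
    {X : Fin 3 → F →L[ℝ] F} (hX : ∀ i v, X i (L i v) = L i (X i v)) (hsum : X 0 + X 1 + X 2 = 0) (i : Fin 3) :
    (∀ v, X i (I v) = I (X i v)) ∧ ∀ v, X i (J v) = J (X i v) := by
  -- quaternionic coordinates `X i = A i + B i I + C i J + D i K`
  choose A B C D hAI hAJ hBI hBJ hCI hCJ hDI hDJ hXeq using fun i ↦ exists_quatCoord hI hJ hIJ (X i)
  set M : Fin 3 → F →L[ℝ] F := fun i ↦ u i 0 • B i + u i 1 • C i + u i 2 • D i with hM
  -- §7: `(B i, C i, D i) = (aᵢ, bᵢ, cᵢ) M i`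
  have hpar : ∀ i, B i = u i 0 • M i ∧ C i = u i 1 • M i ∧ D i = u i 2 • M i := fun i ↦ by
    refine quatCoord_parallel_of_comm_twistor hI hJ hIJ (hAI i) (hAJ i) (hBI i) (hBJ i) (hCI i) (hCJ i) (hDI i)
      (hDJ i) (hu i) fun v ↦ ?_
    rw [← hXeq i, ← hL i]
    exact hX i v
  -- §6: the coordinate sums vanish
  have hS : (A 0 + A 1 + A 2) + (B 0 + B 1 + B 2).comp I + (C 0 + C 1 + C 2).comp J +
      (D 0 + D 1 + D 2).comp (I.comp J) = 0 := by
    rw [← hsum, hXeq 0, hXeq 1, hXeq 2]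
    simp only [ContinuousLinearMap.add_comp]
    abel
  obtain ⟨-, hB0, hC0, hD0⟩ := quatCoord_eq_zero hI hJ hIJ (fun v ↦ by simp [hAI]) (fun v ↦ by simp [hAJ])
    (fun v ↦ by simp [hBI]) (fun v ↦ by simp [hBJ]) (fun v ↦ by simp [hCI]) (fun v ↦ by simp [hCJ])
    (fun v ↦ by simp [hDI]) (fun v ↦ by simp [hDJ]) hS
  have hcol : ∀ j : Fin 3, ∑ k : Fin 3, u k j • M k = 0 := by
    intro j
    fin_cases j
    · show ∑ k : Fin 3, u k 0 • M k = 0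
      rw [Fin.sum_univ_three, ← (hpar 0).1, ← (hpar 1).1, ← (hpar 2).1]; exact hB0
    · show ∑ k : Fin 3, u k 1 • M k = 0
      rw [Fin.sum_univ_three, ← (hpar 0).2.1, ← (hpar 1).2.1, ← (hpar 2).2.1]; exact hC0
    · show ∑ k : Fin 3, u k 2 • M k = 0
      rw [Fin.sum_univ_three, ← (hpar 0).2.2, ← (hpar 1).2.2, ← (hpar 2).2.2]; exact hD0
  -- invert the coefficient matrix
  have hMk : ∀ k, M k = 0 := by
    intro k
    set U : Matrix (Fin 3) (Fin 3) ℝ := Matrix.of u with hU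
    have hUnit : IsUnit U := Matrix.linearIndependent_rows_iff_isUnit.mp (by simpa [hU] using hli)
    have hUW : U * U⁻¹ = 1 := Matrix.mul_nonsing_inv U ((Matrix.isUnit_iff_isUnit_det U).mp hUnit)
    calc M k = ∑ l : Fin 3, (1 : Matrix (Fin 3) (Fin 3) ℝ) l k • M l := by
            simp [Matrix.one_apply, ite_smul, eq_comm]
      _ = ∑ l : Fin 3, (∑ j : Fin 3, U l j * U⁻¹ j k) • M l := by simp_rw [← hUW, Matrix.mul_apply]
      _ = ∑ j : Fin 3, U⁻¹ j k • ∑ l : Fin 3, u l j • M l := by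
            simp_rw [Finset.sum_smul, Finset.smul_sum, smul_smul, hU, Matrix.of_apply, mul_comm (u _ _)]
            rw [Finset.sum_comm]
      _ = 0 := by simp [hcol]
  have hXi : X i = A i := by
    rw [hXeq i, (hpar i).1, (hpar i).2.1, (hpar i).2.2, hMk i]
    simp
  rw [hXi]
  exact ⟨hAI i, hAJ i⟩

/-- **Proposition 2.5, spanning half: "`T_eG/T_eG_ℍ` also decomposes into the direct sum of its subspaces
`Vᵢ := T_eG_{Iᵢ}/T_eG_ℍ`, `i = 1, 2, 3`"** — for linearly independent coefficient rows `(aᵢ, bᵢ, cᵢ)` every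
`X ∈ End(V_ℝ)` is `X₁ + X₂ + X₃` with `Xᵢ ∈ T_eG_{Iᵢ}`: in quaternionic coordinates `X = A + BI + CJ + DK`, put
`Mᵢ = Σⱼ (U⁻¹)ⱼᵢ (B, C, D)ⱼ` (`U` the coefficient matrix) and `X₁ = A + M₁I₁`, `X₂ = M₂I₂`, `X₃ = M₃I₃` (our road, as for the
directness half; no dimension count needed). [cite: BuskinIzadi2020TwistorLinesTori, v2 §2.2 Prop. 2.5, proof (p.11 L47–48)] -/
theorem exists_sum_three_eq_of_linearIndependent {I J : F →L[ℝ] F} (hI : ∀ v, I (I v) = -v) (hJ : ∀ v, J (J v) = -v)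
    (hIJ : ∀ v, J (I v) = -I (J v)) {u : Fin 3 → Fin 3 → ℝ} (hli : LinearIndependent ℝ u) {L : Fin 3 → F →L[ℝ] F}
    (hL : ∀ i, L i = u i 0 • I + u i 1 • J + u i 2 • I.comp J) (X : F →L[ℝ] F) :
    ∃ X' : Fin 3 → F →L[ℝ] F, (∀ i v, X' i (L i v) = L i (X' i v)) ∧ X = X' 0 + X' 1 + X' 2 := by
  obtain ⟨A, B, C, D, hAI, hAJ, hBI, hBJ, hCI, hCJ, hDI, hDJ, hXeq⟩ := exists_quatCoord hI hJ hIJ X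
  set U : Matrix (Fin 3) (Fin 3) ℝ := Matrix.of u with hU
  have hUnit : IsUnit U := Matrix.linearIndependent_rows_iff_isUnit.mp (by simpa [hU] using hli)
  have hWU : U⁻¹ * U = 1 := Matrix.nonsing_inv_mul U ((Matrix.isUnit_iff_isUnit_det U).mp hUnit)
  -- the nine scalar identities `Σᵢ (U⁻¹)ⱼᵢ uᵢₖ = δⱼₖ`
  have e : ∀ j k : Fin 3, U⁻¹ j 0 * u 0 k + U⁻¹ j 1 * u 1 k + U⁻¹ j 2 * u 2 k = if j = k then 1 else 0 := by
    intro j k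
    have := congrFun (congrFun hWU j) k
    simpa [Matrix.mul_apply, Fin.sum_univ_three, hU, Matrix.one_apply] using this
  -- the coefficients `Mᵢ ∈ T_eG_ℍ`
  set M : Fin 3 → F →L[ℝ] F := fun i ↦ U⁻¹ 0 i • B + U⁻¹ 1 i • C + U⁻¹ 2 i • D with hM
  have hMI : ∀ i v, M i (I v) = I (M i v) := fun i v ↦ by simp [hM, hBI, hCI, hDI]
  have hMJ : ∀ i v, M i (J v) = J (M i v) := fun i v ↦ by simp [hM, hBJ, hCJ, hDJ]
  refine ⟨![A + (M 0).comp (L 0), (M 1).comp (L 1), (M 2).comp (L 2)], fun i v ↦ ?_, ?_⟩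
  · fin_cases i
    · simpa [hL] using comm_twistor_of_quatCoord_parallel hI hJ hIJ hAI hAJ (hMI 0) (hMJ 0) (u 0 0) (u 0 1) (u 0 2) v
    · simpa [hL] using comm_twistor_of_quatCoord_parallel (A := 0) hI hJ hIJ (fun _ ↦ by simp) (fun _ ↦ by simp)
        (hMI 1) (hMJ 1) (u 1 0) (u 1 1) (u 1 2) v
    · simpa [hL] using comm_twistor_of_quatCoord_parallel (A := 0) hI hJ hIJ (fun _ ↦ by simp) (fun _ ↦ by simp)
        (hMI 2) (hMJ 2) (u 2 0) (u 2 1) (u 2 2) v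
  · have e00 := e 0 0; have e01 := e 0 1; have e02 := e 0 2
    have e10 := e 1 0; have e11 := e 1 1; have e12 := e 1 2
    have e20 := e 2 0; have e21 := e 2 1; have e22 := e 2 2
    simp only [Fin.isValue, Fin.reduceEq, ↓reduceIte] at e00 e01 e02 e10 e11 e12 e20 e21 e22
    have h3 : (![A + (M 0).comp (L 0), (M 1).comp (L 1), (M 2).comp (L 2)] : Fin 3 → F →L[ℝ] F) 0 +
        ![A + (M 0).comp (L 0), (M 1).comp (L 1), (M 2).comp (L 2)] 1 +
        ![A + (M 0).comp (L 0), (M 1).comp (L 1), (M 2).comp (L 2)] 2 =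
        (A + (M 0).comp (L 0)) + (M 1).comp (L 1) + (M 2).comp (L 2) := by simp
    rw [h3]
    simp only [hM, hL 0, hL 1, hL 2, hXeq, ContinuousLinearMap.add_comp, ContinuousLinearMap.comp_add,
      ContinuousLinearMap.smul_comp, ContinuousLinearMap.comp_smul]
    linear_combination (norm := module) -(e00 • B.comp I) - e01 • B.comp J - e02 • B.comp (I.comp J) -
      e10 • C.comp I - e11 • C.comp J - e12 • C.comp (I.comp J) - e20 • D.comp I - e21 • D.comp J -
      e22 • D.comp (I.comp J)

/-- A point of the twistor sphere, `L = aI + bJ + cK` with `a² + b² + c² = 1`, does NOT lie in `T_eG_ℍ` (`V_ℝ ≠ 0`):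
`[L, I] = 2(cJ − bK)`, `[L, J] = 2(aK − cI)`. [cite: BuskinIzadi2020TwistorLinesTori, v2 §1.1 (p.5 L36–38), §1.7 Cor. 1.8 (p.8 L31–35:
the tangent plane `⟨J, K⟩ ⊂ T_I Compl` of `S` at `I`)] -/
theorem not_comm_of_mem_sphere [Nontrivial F] {I J : F →L[ℝ] F} (hI : ∀ v, I (I v) = -v) (hJ : ∀ v, J (J v) = -v)
    (hIJ : ∀ v, J (I v) = -I (J v)) {a b c : ℝ} (habc : a ^ 2 + b ^ 2 + c ^ 2 = 1)
    (hLI : ∀ v, (a • I + b • J + c • I.comp J) (I v) = I ((a • I + b • J + c • I.comp J) v))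
    (hLJ : ∀ v, (a • I + b • J + c • I.comp J) (J v) = J ((a • I + b • J + c • I.comp J) v)) : False := by
  have h1 : (0 : ℝ) • I + (2 * c) • J + (-(2 * b)) • I.comp J = 0 := by
    ext v
    have h := hLI v
    simp only [_root_.add_apply, _root_.smul_apply, ContinuousLinearMap.coe_comp, Function.comp_apply, map_add, map_smul,
      hI, hIJ, map_neg, smul_neg, _root_.zero_apply] at h ⊢
    linear_combination (norm := module) h
  have h2 : (-(2 * c)) • I + (0 : ℝ) • J + (2 * a) • I.comp J = 0 := by
    ext v
    have h := hLJ v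
    simp only [_root_.add_apply, _root_.smul_apply, ContinuousLinearMap.coe_comp, Function.comp_apply, map_add, map_smul,
      hJ, hIJ, map_neg, smul_neg, neg_neg, _root_.zero_apply] at h ⊢
    linear_combination (norm := module) h
  obtain ⟨-, hc, hb⟩ := coeff_eq_zero_of_twistor_eq_zero hI hJ hIJ h1
  obtain ⟨-, -, ha⟩ := coeff_eq_zero_of_twistor_eq_zero hI hJ hIJ h2
  have : a = 0 ∧ b = 0 ∧ c = 0 := ⟨by linarith, by linarith, by linarith⟩
  obtain ⟨rfl, rfl, rfl⟩ := this
  norm_num at habc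

/-- **Proposition 2.5 (Buskin–Izadi), "only if": transversal `I₁, I₂, I₃ ∈ S` are linearly independent.** If
`Σᵢ gᵢ(aᵢ, bᵢ, cᵢ) = 0` with some `gᵢ ≠ 0`, then `Xᵢ := gᵢIᵢ ∈ T_eG_{Iᵢ}` sum to zero while `gᵢIᵢ ∉ T_eG_ℍ`.
[cite: BuskinIzadi2020TwistorLinesTori, v2 §2.2 Prop. 2.5 (p.11 L39–41, p.12 L83–85)] -/
theorem linearIndependent_of_transversal [Nontrivial F] {I J : F →L[ℝ] F} (hI : ∀ v, I (I v) = -v)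
    (hJ : ∀ v, J (J v) = -v) (hIJ : ∀ v, J (I v) = -I (J v)) {u : Fin 3 → Fin 3 → ℝ}
    (hu : ∀ i, u i 0 ^ 2 + u i 1 ^ 2 + u i 2 ^ 2 = 1) {L : Fin 3 → F →L[ℝ] F}
    (hL : ∀ i, L i = u i 0 • I + u i 1 • J + u i 2 • I.comp J)
    (htr : ∀ X : Fin 3 → F →L[ℝ] F, (∀ i v, X i (L i v) = L i (X i v)) → X 0 + X 1 + X 2 = 0 →
      ∀ i, (∀ v, X i (I v) = I (X i v)) ∧ ∀ v, X i (J v) = J (X i v)) :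
    LinearIndependent ℝ u := by
  by_contra hdep
  obtain ⟨g, hg, i, hi⟩ := Fintype.not_linearIndependent_iff.mp hdep
  have hsum : (g 0 • L 0) + (g 1 • L 1) + (g 2 • L 2) = 0 := by
    have h0 : ∀ j : Fin 3, (∑ k : Fin 3, g k • u k) j = 0 := fun j ↦ by rw [hg]; rfl
    simp only [Finset.sum_apply, Pi.smul_apply, smul_eq_mul, Fin.sum_univ_three] at h0
    rw [hL 0, hL 1, hL 2]
    have e : g 0 • (u 0 0 • I + u 0 1 • J + u 0 2 • I.comp J) + g 1 • (u 1 0 • I + u 1 1 • J + u 1 2 • I.comp J) +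
        g 2 • (u 2 0 • I + u 2 1 • J + u 2 2 • I.comp J) =
        (g 0 * u 0 0 + g 1 * u 1 0 + g 2 * u 2 0) • I + (g 0 * u 0 1 + g 1 * u 1 1 + g 2 * u 2 1) • J +
          (g 0 * u 0 2 + g 1 * u 1 2 + g 2 * u 2 2) • I.comp J := by module
    rw [e, h0 0, h0 1, h0 2, zero_smul, zero_smul, zero_smul, add_zero, add_zero]
  have hcomm := htr (fun k ↦ g k • L k) (fun k v ↦ by simp only [_root_.smul_apply, map_smul]) hsum i
  obtain ⟨hXI, hXJ⟩ := hcomm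
  refine not_comm_of_mem_sphere hI hJ hIJ (hu i) (fun v ↦ ?_) (fun v ↦ ?_)
  · have h := hXI v
    simp only [_root_.smul_apply, map_smul] at h
    rw [← hL i]
    exact smul_right_injective F hi h
  · have h := hXJ v
    simp only [_root_.smul_apply, map_smul] at h
    rw [← hL i]
    exact smul_right_injective F hi h

/-- **Proposition 2.5 (Buskin–Izadi).** "Let `I₁, I₂, I₃` be complex structures belonging to the same twistor sphere `S`. The
submanifolds `G_{I₁}/G_ℍ, G_{I₂}/G_ℍ, G_{I₃}/G_ℍ` in `G/G_ℍ` intersect transversally (as a triple) if and only if `I₁, I₂, I₃`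
are linearly independent as vectors in `End(V_ℝ)`" — at the tangent spaces at `eG_ℍ`: the sum `V_{I₁} + V_{I₂} + V_{I₃}`,
`Vᵢ = T_eG_{Iᵢ}/T_eG_ℍ`, in `T_eG/T_eG_ℍ` is direct iff `I₁, I₂, I₃` are linearly independent (`V_ℝ ≠ 0`).
[cite: BuskinIzadi2020TwistorLinesTori, v2 §2.2 Prop. 2.5 (p.11 L39–41), proof p.11 L42–p.12 L85] -/
theorem transversal_iff_linearIndependent [Nontrivial F] {I J : F →L[ℝ] F} (hI : ∀ v, I (I v) = -v)
    (hJ : ∀ v, J (J v) = -v) (hIJ : ∀ v, J (I v) = -I (J v)) {u : Fin 3 → Fin 3 → ℝ}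
    (hu : ∀ i, u i 0 ^ 2 + u i 1 ^ 2 + u i 2 ^ 2 = 1) {L : Fin 3 → F →L[ℝ] F}
    (hL : ∀ i, L i = u i 0 • I + u i 1 • J + u i 2 • I.comp J) :
    (∀ X : Fin 3 → F →L[ℝ] F, (∀ i v, X i (L i v) = L i (X i v)) → X 0 + X 1 + X 2 = 0 →
      ∀ i, (∀ v, X i (I v) = I (X i v)) ∧ ∀ v, X i (J v) = J (X i v)) ↔ LinearIndependent ℝ L := by
  rw [linearIndependent_twistor_iff hI hJ hIJ hL]
  exact ⟨linearIndependent_of_transversal hI hJ hIJ hu hL,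
    fun hli X hX hsum i ↦ comm_of_sum_eq_zero_of_linearIndependent hI hJ hIJ hu hli hL hX hsum i⟩

/-- **"Proposition 2.5 tells us that, when `I₁, J₁, K₁` are linearly independent, `Φ_{I₁,J₁,K₁}` is a submersion near
`(e, e) ∈ G_{J₁} × G_{K₁}`"** — the kernel half at the Lie-algebra level, generalising Prop. 2.1 from a quaternionic triple to
any three linearly independent points `I₁, J₁, K₁` of one twistor sphere: for `X ∈ T_eG_{J₁}`, `Y ∈ T_eG_{K₁}` with
`dΦ(X + Y) = (X + Y)I₁ − I₁(X + Y) = 0`, both `X, Y ∈ T_eG_ℍ` (apply Prop. 2.5 to `X + Y + (−(X + Y)) = 0`, the last term in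
`T_eG_{I₁}`). [cite: BuskinIzadi2020TwistorLinesTori, v2 §3 (p.13 L51–52), §2.2 Prop. 2.5] -/
theorem comm_of_bracket_eq_zero_of_linearIndependent [Nontrivial F] {I J : F →L[ℝ] F} (hI : ∀ v, I (I v) = -v)
    (hJ : ∀ v, J (J v) = -v) (hIJ : ∀ v, J (I v) = -I (J v)) {u : Fin 3 → Fin 3 → ℝ}
    (hu : ∀ i, u i 0 ^ 2 + u i 1 ^ 2 + u i 2 ^ 2 = 1) {L : Fin 3 → F →L[ℝ] F}
    (hL : ∀ i, L i = u i 0 • I + u i 1 • J + u i 2 • I.comp J) (hli : LinearIndependent ℝ L) {X Y : F →L[ℝ] F}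
    (hX : ∀ v, X (L 1 v) = L 1 (X v)) (hY : ∀ v, Y (L 2 v) = L 2 (Y v))
    (h : (X + Y).comp (L 0) - (L 0).comp (X + Y) = 0) :
    ((∀ v, X (I v) = I (X v)) ∧ ∀ v, X (J v) = J (X v)) ∧ ((∀ v, Y (I v) = I (Y v)) ∧ ∀ v, Y (J v) = J (Y v)) := by
  have hli' := (linearIndependent_twistor_iff hI hJ hIJ hL).mp hli
  have hZ : ∀ v, (-(X + Y)) (L 0 v) = L 0 ((-(X + Y)) v) := fun v ↦ by
    have := congrArg (fun T : F →L[ℝ] F ↦ T v) h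
    simp only [_root_.sub_apply, ContinuousLinearMap.coe_comp, Function.comp_apply, _root_.zero_apply, sub_eq_zero] at this
    simp only [_root_.neg_apply, map_neg, this]
  have key := fun i ↦ comm_of_sum_eq_zero_of_linearIndependent hI hJ hIJ hu hli' hL (X := ![-(X + Y), X, Y])
    (fun k v ↦ by
      fin_cases k
      · simpa using hZ v
      · simpa using hX v
      · simpa using hY v) (by simp) i
  exact ⟨key 1, key 2⟩

end Literature.Geometry.Hyperkaehler.TwistorPath
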